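import Summits.HodgeConjecture.HodgeConjecture.Theorems.Ring2HypothesesWeilComponentsLadder
import Literature.AlgebraicGeometry.VanGeemen1994.WeilDiscriminantOfHyperbolic
import Literature.AlgebraicGeometry.HodgeTheory.HyperbolicWeilTypeExistence
import HarnessLib

/-!
# Ring 2 — hypotheses layer, part XXVIII: the SPLIT cells `(ℚ(√-d), 2n, δ = (-1)ⁿ)` after the forward half of Landherr landed — R2 / R2₈ / the F2-shape from the split cells FACT-FREE, the split cells INHABITED in the kernel, and the binder that remains

HONEST FRAMING (page 1, unchanged): research route conditional on HC_CM; not a corollary; Q11.4-sentence-2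
already refuted in dim ≥ 3. `HC_CM` (`Theses.RankFourFaces.CMAbelianHodge`, by name) does not occur in this file;
nothing here asserts `HC_CM`, `HC_AV`, `HodgeConjecture` or any rung. Cell `pub-hodge-ring2`, seat
`pub-hodge-ring2-typer2`, gen 18; companion of parts VII-A (`Ring2HypothesesWeilComponents`: the δ-cells
`WeilClassesComponent n d δ`) and VII-B (`Ring2HypothesesWeilComponentsLadder`: rows W3–W5 and the two typed print
obligations `PolarizedWeilDiscriminantExists` = van Geemen Lemma 5.2 (1)–(3), `LandherrSplitCriterion` = van Geemen
5.4 / (5.4.1) after Landherr). Sorry-free; no new axiom; every theorem is a short composition.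

## The trigger

The Literature THEOREM `VanGeemen1994.hasWeilDiscriminantNondeg_neg_one_pow_of_isHyperbolicWeilType`
(`Literature/AlgebraicGeometry/VanGeemen1994/WeilDiscriminantOfHyperbolic.lean`, landed 2026-08-20): for a complex
abelian `2n`-fold `(A, φ)`, `φ ≫ φ = -d`, `n, d ≥ 1`, and a `K`-symmetrised hyperplane class
`h_K = d·e^*a + φ^*e^*a` (`a ≠ 0` rational), HYPERBOLIC (`Motives.IsHyperbolicWeilType A φ n h_K`) ⟹
`HasWeilDiscriminantNondeg A φ n d h_K [(-1)ⁿ]` — van Geemen (5.4.1) "`det H = (-1)ⁿ a`" with `a = 1`, Deligne–Milne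
LNM 900 §4 Cor. 4.2 (b) ⟹ (a). This is the FORWARD half of part VII-B's obligation node `LandherrSplitCriterion`
(an `↔`); its Weil-class hypothesis is not needed for this half. The CONVERSE half (Landherr 1936: `det H = (-1)ⁿ`
modulo norms ⟹ hyperbolic, the Hasse principle for Hermitian forms over `K`; Deligne–Milne (a) ⟹ (b)) is NOT in the
tree.

## What is here (all FACT-FREE unless a binder is displayed)

| row | theorem | binder | content |
|---|---|---|---|
| S1 | `weilClasses_algebraic_of_isSplitWeilType_of_split_component` | — | the split cell `(n, d, (-1)ⁿ)` COVERS the split locus: every rational `(n,n)` Weil class on every pair of split Weil type `(n, d)` (`HodgeTheory.IsSplitWeilType`) is algebraic, EVERY `n ≥ 1` (was: via `LandherrSplitCriterion.1`) |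
| S2 | `splitWeilAbelianVarieties_of_split_components_holds`, `splitEightfolds_of_split_components_holds`, `hyperbolicSixfolds_of_split_components_holds` | — | rung R2 (`n ≥ 4`), rung R2₈ (`n = 4`) and the STATEMENT of the floor fact F2 (`Markman2025_weilClasses_algebraic_hyperbolicSixfold`, `n = 3`; NOT asserted — an implication INTO it) from the split cells; VII-B's W4 (←) `splitWeilAbelianVarieties_of_split_components (hL)` loses its binder |
| S3 | `weilClassesComponent_split_inhabited`, `hasWeilDiscriminantNondeg_inhabited` | — | ANTI-VACUITY: for every `n ≥ 2`, `d ≥ 1` the split cell has a MEMBER — an abelian `2n`-fold `(A, φ, e, a)` with `det H = [(-1)ⁿ]` NON-DEGENERATE on the carriers AND a non-zero rational `(n,n)` Weil class; the first kernel inhabitant of any `HasWeilDiscriminantNondeg … δ` (gen-14 census §5 had inhabitation of the δ-cells only in print, via the typed Lemma 5.2) |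
| S4 | `exists_hasWeilDiscriminantNondeg_of_isSplitWeilType`, `weilClasses_algebraic_of_isSplitWeilType_of_byComponent` | — | van Geemen's Lemma 5.2 (1)–(3) (`PolarizedWeilDiscriminantExists`) holds ON SPLIT-TYPE PAIRS; hence W3 restricted to split type needs no binder |
| S5 | `@[conjecture] LandherrHyperbolicOfSplitDiscriminant`, `landherrSplitCriterion_iff_hyperbolicOfSplitDiscriminant` | — | the binder that REMAINS is exactly Landherr's converse half: `LandherrSplitCriterion ↔ LandherrHyperbolicOfSplitDiscriminant` in the kernel; its Weil-class hypothesis cannot be dropped (a DEFINITE `H` of rank `4` with `det H = 1 = (-1)²` is not hyperbolic — e.g. `E⁴` with `ℚ(i)` acting by one CM type; off Weil type the node is not claimed) |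
| S6 | `splitWeilAbelianVarieties_iff_split_components_of_converse`, `nonsplitSixfolds_of_nonsplit_components_of_converse`, `weilClassesComponent_split_*_of_converse` | the converse half (+ Lemma 5.2 for R1′; the cell's floor fact) | VII-B's rows W4 (→ and ↔), R1′ and the five known cells W5 RE-BASED on the converse half alone; part XIII's three PW5 rows re-base by `landherrSplitCriterion_of_hyperbolicOfSplitDiscriminant` in one term (not repeated) |

KIND OF `HC_CM` on every row: ABSENT. ON-PATH: the split cells are cases of the summit by VII-B
`weilClassesComponent_of_hodgeConjecture`; the new node is a THEOREM IN PRINT about Hermitian forms (no on-path lemma is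
meaningful, as for `LandherrSplitCriterion`). PRINT STATUS of the split cells: `n = 2` all `d` [Markman 2025,
UNREFEREED; `δ = +1` Markman JEMS 2023 REFEREED], `n = 3` all `d` [Markman 2025, UNREFEREED; `d ∈ {1, 3}` Koike 2004 /
Schoen 1988–1998 REFEREED], `n ≥ 4` OPEN ("dim `≥ 8`: nothing for any `K`", arXiv:2502.03415 §1.2). WHAT THE KERNEL ROWS
ADD about Hodge classes: NOTHING new is algebraic; S3's member is a product tower of CM elliptic curves and Weil
surfaces (`HodgeTheory.exists_isHyperbolicWeilType_with_weilClass`), whose Weil classes are classically algebraic.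

## References

* [vanGeemen1994HodgeAV] B. van Geemen, LNM 1594 (1994): Lemma 5.2 (1)–(4), 5.4 and (5.4.1) (PDF p. 220), 5.5, 4.14.
* [Landherr1936HermitianForms] W. Landherr, Abh. Math. Sem. Hamburg 11 (1936) — the converse half, NOT in the tree.
* [Deligne1982HodgeCycles] P. Deligne (notes by J. Milne), LNM 900 (1982), §4 Cor. 4.2, Prop. 4.4, proof of Thm. 4.8.
* [Markman2025SurveySecant] E. Markman, arXiv:2509.23403, §11.5 Steps 1–2, §12. [Markman2025SecantWeil] arXiv:2502.03415
  (UNREFEREED) §1.1–1.2, Thm. 1.5.1. [Markman2023GeneralizedKummers] JEMS 2023 Thm. 1.5 (= Thm. 13.4), p. 236 (pre-v4 arXiv text: Thm. 1.3). [Schoen1998HodgeWeilAddendum],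
  [Koike2004WeilHodge].
-/

-- The summit's namespace repeats `HodgeConjecture` (summit = sub-problem); every file of the axis disables this linter.
set_option linter.dupNamespace false

noncomputable section

open CategoryTheory
open Literature.AlgebraicGeometry Literature.AlgebraicGeometry.Motives
open Literature.AlgebraicGeometry.HodgeTheory
open Literature.AlgebraicTopology.SingularHomology
open Literature.AlgebraicGeometry.VanGeemen1994
open Summit.HodgeConjecture.HodgeConjecture.WeilTypeLadder
open Summit.HodgeConjecture.HodgeConjecture.Theses

namespace Summit.HodgeConjecture.HodgeConjecture.Ring2.Hypotheses

/-! ### §1 The split cell covers the split locus (S1) — every `n ≥ 1`, fact-free -/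

/-- **S1 — the split cell COVERS the split locus, FACT-FREE.** If the class target of the component
`(ℚ(√-d), 2n, (-1)ⁿ)` holds, then on EVERY pair `(A, φ)` of SPLIT Weil type `(n, d)` (`HodgeTheory.IsSplitWeilType`:
Weil type and some `K`-symmetrised hyperplane class hyperbolic) every rational `(n,n)` Weil class is algebraic —
for every `n ≥ 1`: the hyperbolic class has non-degenerate discriminant `(-1)ⁿ` by the tree theorem
`hasWeilDiscriminantNondeg_neg_one_pow_of_isHyperbolicWeilType` (was: the forward use of the binder
`LandherrSplitCriterion`). [cite: vanGeemen1994HodgeAV, Lemma 5.2 (2)–(3) and 5.4 (5.4.1)]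
[cite: Markman2025SurveySecant, §11.5 Step 1] -/
theorem weilClasses_algebraic_of_isSplitWeilType_of_split_component {n d : ℕ}
    (h : WeilClassesComponent n d (splitDiscriminantClass n d)) {A : AbelianVariety ℂ} {φ : A ⟶ A}
    (hsplit : IsSplitWeilType A φ n d) {c : complexBetti A.X (2 * n)} (hcQ : IsRationalClass c)
    (hcH : IsOfHodgeType (2 * n) A.X (2 * n) n n c) (hw : c ∈ weilClassesOf A φ n d) :
    c ∈ algebraicClasses A.X n := by
  obtain ⟨hn, hd, hA, hφ, e, a, ha, ha0, hh⟩ := isSplitWeilType_iff.1 hsplit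
  exact h A φ hA (isSmoothProjective_of_dim_eq' hA) hφ e a ha ha0
    (hasWeilDiscriminantNondeg_neg_one_pow_of_isHyperbolicWeilType hn hA hd hφ e ha ha0 hh) c hcQ hcH hw

/-- S1, pointwise form on the carriers (the shape of the rungs' inline hypotheses): a hyperbolic `K`-symmetrised
hyperplane class puts `(A, φ, e, a)` on the split cell, so the cell's target applies. Every `n ≥ 1`; fact-free.
[cite: vanGeemen1994HodgeAV, (5.4.1)] -/
theorem weilClasses_algebraic_of_isHyperbolicWeilType_of_split_component {n d : ℕ} (hn : 0 < n) (hd : 0 < d)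
    (h : WeilClassesComponent n d (splitDiscriminantClass n d)) {A : AbelianVariety ℂ} {φ : A ⟶ A}
    (hA : A.dim = 2 * n) (hX : IsSmoothProjective (2 * n) A.X) (hφ : φ ≫ φ = -(d • 𝟙 A))
    (e : ProjectiveEmbedding A.X) {a : complexBetti (projectiveSpace e.n ℂ) 2} (haQ : IsRationalClass a)
    (ha0 : a ≠ 0)
    (hhyp : IsHyperbolicWeilType A φ n
      ((d : ℂ) • complexBetti.map e.ι 2 a + complexBetti.map φ.hom.hom.hom 2 (complexBetti.map e.ι 2 a)))
    {c : complexBetti A.X (2 * n)} (hcQ : IsRationalClass c) (hcH : IsOfHodgeType (2 * n) A.X (2 * n) n n c)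
    (hw : c ∈ weilClassesOf A φ n d) : c ∈ algebraicClasses A.X n :=
  h A φ hA hX hφ e a haQ ha0
    (hasWeilDiscriminantNondeg_neg_one_pow_of_isHyperbolicWeilType hn hA hd hφ e haQ ha0 hhyp) c hcQ hcH hw

/-! ### §2 R2, R2₈ and the F2-shape from the split cells, fact-free (S2) -/

/-- **S2 — W4 (←) WITHOUT ITS BINDER: the split cells `(n, d, (-1)ⁿ)`, `n ≥ 4`, `d ≥ 1`, give rung R2
`SplitWeilAbelianVarieties`**, fact-free (VII-B's `splitWeilAbelianVarieties_of_split_components` carried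
`(hL : LandherrSplitCriterion)` for this). [cite: vanGeemen1994HodgeAV, (5.4.1)] [cite: Markman2025SurveySecant, §12] -/
theorem splitWeilAbelianVarieties_of_split_components_holds
    (h : ∀ (n : ℕ), 4 ≤ n → ∀ (d : ℕ), 0 < d → WeilClassesComponent n d (splitDiscriminantClass n d)) :
    SplitWeilAbelianVarieties :=
  fun n hn d hd A φ hA hX hφ e a haQ ha0 hhyp c hcQ hcH hw ↦
    weilClasses_algebraic_of_isHyperbolicWeilType_of_split_component (by omega) hd (h n hn d hd) hA hX hφ e haQ
      ha0 hhyp hcQ hcH hw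

/-- S2 — rung R2₈ `SplitEightfolds` (split abelian EIGHTFOLDS, every `d`) from the split eightfold cells `(4, d, +1)`,
fact-free. [cite: Markman2025SecantWeil, §1.2 (preprint, unrefereed)] [cite: vanGeemen1994HodgeAV, (5.4.1)] -/
theorem splitEightfolds_of_split_components_holds
    (h : ∀ (d : ℕ), 0 < d → WeilClassesComponent 4 d (splitDiscriminantClass 4 d)) : SplitEightfolds :=
  fun d hd A φ hA hX hφ e a haQ ha0 hhyp c hcQ hcH hw ↦
    weilClasses_algebraic_of_isHyperbolicWeilType_of_split_component (by norm_num) hd (h d hd) hA hX hφ e haQ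
      ha0 hhyp hcQ hcH hw

/-- S2 — the STATEMENT of the floor fact F2 (`Markman2025_weilClasses_algebraic_hyperbolicSixfold`: Weil classes on
hyperbolic abelian sixfolds, every `d`) FOLLOWS from the split sixfold cells `(3, d, -1)`, fact-free. (F2 is NOT
asserted: this is an implication into a named statement; with VII-B's `weilClassesComponent_split_three_of_markmanSixfolds`
the cells and F2 are EQUIVALENT granted the converse half of Landherr.)
[cite: Markman2025SecantWeil, Thm. 1.5.1 (preprint, unrefereed)] [cite: vanGeemen1994HodgeAV, (5.4.1)] -/
theorem hyperbolicSixfolds_of_split_components_holds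
    (h : ∀ (d : ℕ), 0 < d → WeilClassesComponent 3 d (splitDiscriminantClass 3 d)) :
    Markman2025_weilClasses_algebraic_hyperbolicSixfold :=
  fun d hd A φ hA hX hφ e a haQ ha0 hhyp c hcQ hcH hw ↦
    weilClasses_algebraic_of_isHyperbolicWeilType_of_split_component (by norm_num) hd (h d hd) hA hX hφ e haQ
      ha0 hhyp hcQ hcH hw

/-! ### §3 Anti-vacuity: the split cells are inhabited in the kernel (S3) -/

/-- **S3 — the split cell `(ℚ(√-d), 2n, (-1)ⁿ)` is INHABITED, fact-free (`n ≥ 2`, `d ≥ 1`).** There is a complex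
abelian `2n`-fold `(A, φ)`, `φ ≫ φ = -d`, with a `K`-symmetrised hyperplane class `d·e^*a + φ^*e^*a` of NON-DEGENERATE
discriminant `det H = [(-1)ⁿ]` on the carriers AND a non-zero rational `(n,n)` class in its Weil plane: the
hyperbolic tower of `HodgeTheory.exists_isHyperbolicWeilType_with_weilClass` (products of a CM square `E × E` with Weil
surfaces, van Geemen 5.5 / Markman §11.5 Step 2), placed on the split cell by the forward half of Landherr. So the
premises of `WeilClassesComponent n d [(-1)ⁿ]` are jointly satisfiable — the target is not vacuous.
[cite: vanGeemen1994HodgeAV, Lemma 5.2 (2)–(3), 5.4–5.5] [cite: Markman2025SurveySecant, §11.5 Steps 1–2] -/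
theorem weilClassesComponent_split_inhabited {n d : ℕ} (hn : 2 ≤ n) (hd : 0 < d) :
    ∃ (A : AbelianVariety ℂ) (φ : A ⟶ A) (e : ProjectiveEmbedding A.X)
      (a : complexBetti (projectiveSpace e.n ℂ) 2) (c : complexBetti A.X (2 * n)),
      A.dim = 2 * n ∧ IsSmoothProjective (2 * n) A.X ∧ φ ≫ φ = -(d • 𝟙 A) ∧ IsRationalClass a ∧ a ≠ 0 ∧
        HasWeilDiscriminantNondeg A φ n d
          ((d : ℂ) • complexBetti.map e.ι 2 a + complexBetti.map φ.hom.hom.hom 2 (complexBetti.map e.ι 2 a))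
          (splitDiscriminantClass n d) ∧
        c ∈ weilClassesOf A φ n d ∧ IsRationalClass c ∧ IsOfHodgeType (2 * n) A.X (2 * n) n n c ∧ c ≠ 0 := by
  obtain ⟨P, ψ₀, e, a, w, hP, hψ₀, ha, ha0, hhyp, hwW, hwQ, hw0, hwH⟩ :=
    exists_isHyperbolicWeilType_with_weilClass n d hn hd
  exact ⟨P, ψ₀, e, a, w, hP, isSmoothProjective_of_dim_eq' hP, hψ₀, ha, ha0,
    hasWeilDiscriminantNondeg_neg_one_pow_of_isHyperbolicWeilType (by omega) hP hd hψ₀ e ha ha0 hhyp,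
    hwW, hwQ, hwH, hw0⟩

/-- S3 — in particular the carrier predicate `HasWeilDiscriminantNondeg` ("`det H = δ`, `H` non-degenerate",
van Geemen Lemma 5.2 (2)–(3)) is INHABITED at `δ = [(-1)ⁿ]` for every `n ≥ 2`, `d ≥ 1` — the first instance in the
tree. [cite: vanGeemen1994HodgeAV, Lemma 5.2 (2)–(3) and (5.4.1)] -/
theorem hasWeilDiscriminantNondeg_inhabited {n d : ℕ} (hn : 2 ≤ n) (hd : 0 < d) :
    ∃ (A : AbelianVariety ℂ) (φ : A ⟶ A) (h : complexBetti A.X 2),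
      A.dim = 2 * n ∧ φ ≫ φ = -(d • 𝟙 A) ∧ HasWeilDiscriminantNondeg A φ n d h (splitDiscriminantClass n d) := by
  obtain ⟨A, φ, e, a, -, hA, -, hφ, -, -, hδ, -⟩ := weilClassesComponent_split_inhabited hn hd
  exact ⟨A, φ, _, hA, hφ, hδ⟩

/-- S3 — the split-type locus `IsSplitWeilType · · n d` is inhabited (`n ≥ 2`, `d ≥ 1`): the same tower is of
split Weil type in the Literature sense. [cite: vanGeemen1994HodgeAV, Lemma 5.2 (1) and 5.4–5.5] -/
theorem isSplitWeilType_inhabited {n d : ℕ} (hn : 2 ≤ n) (hd : 0 < d) :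
    ∃ (A : AbelianVariety ℂ) (φ : A ⟶ A), IsSplitWeilType A φ n d := by
  obtain ⟨P, ψ₀, e, a, -, hP, hψ₀, ha, ha0, hhyp, -⟩ := exists_isHyperbolicWeilType_with_weilClass n d hn hd
  exact ⟨P, ψ₀, isSplitWeilType_iff.2 ⟨by omega, hd, hP, hψ₀, e, a, ha, ha0, hhyp⟩⟩

/-! ### §4 Lemma 5.2 (1)–(3) on split-type pairs, fact-free (S4) -/

/-- **S4 — `PolarizedWeilDiscriminantExists` HOLDS ON SPLIT-TYPE PAIRS, fact-free**: a pair of split Weil type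
`(n, d)` carries a `K`-symmetrised hyperplane class of non-degenerate discriminant (namely `[(-1)ⁿ]`) — the
conclusion of VII-B's typed Lemma 5.2 (1)–(3) at such pairs, by the Literature corollary
`VanGeemen1994.IsSplitWeilType.exists_hasWeilDiscriminantNondeg_neg_one_pow`.
[cite: vanGeemen1994HodgeAV, Lemma 5.2 (1)–(3) and (5.4.1)] -/
theorem exists_hasWeilDiscriminantNondeg_of_isSplitWeilType {n d : ℕ} {A : AbelianVariety ℂ} {φ : A ⟶ A}
    (hsplit : IsSplitWeilType A φ n d) :
    ∃ (e : ProjectiveEmbedding A.X) (a : complexBetti (projectiveSpace e.n ℂ) 2) (δ : weilNormResidueGroup d),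
      IsRationalClass a ∧ a ≠ 0 ∧
        HasWeilDiscriminantNondeg A φ n d
          ((d : ℂ) • complexBetti.map e.ι 2 a + complexBetti.map φ.hom.hom.hom 2 (complexBetti.map e.ι 2 a)) δ := by
  obtain ⟨e, a, ha, ha0, hδ⟩ :=
    Literature.AlgebraicGeometry.VanGeemen1994.IsSplitWeilType.exists_hasWeilDiscriminantNondeg_neg_one_pow hsplit
  exact ⟨e, a, _, ha, ha0, hδ⟩

/-- **S4 — W3 on split-type pairs needs no binder**: `WeilClassesByComponent` (every cell, `n ≥ 2`) makes every
rational `(n,n)` Weil class on every split-type pair `(n, d)`, `n ≥ 2`, algebraic — fact-free (VII-B's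
`weilClassesImaginaryQuadratic_of_byComponent` needs the typed Lemma 5.2 `hE` to reach ALL pairs).
[cite: vanGeemen1994HodgeAV, Lemma 5.2 and (5.4.1)] -/
theorem weilClasses_algebraic_of_isSplitWeilType_of_byComponent (h : WeilClassesByComponent) {n d : ℕ}
    (hn : 2 ≤ n) {A : AbelianVariety ℂ} {φ : A ⟶ A} (hsplit : IsSplitWeilType A φ n d)
    {c : complexBetti A.X (2 * n)} (hcQ : IsRationalClass c) (hcH : IsOfHodgeType (2 * n) A.X (2 * n) n n c)
    (hw : c ∈ weilClassesOf A φ n d) : c ∈ algebraicClasses A.X n :=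
  weilClasses_algebraic_of_isSplitWeilType_of_split_component (h n hn d hsplit.isWeilType.d_pos _) hsplit hcQ
    hcH hw

/-! ### §5 The binder that remains: Landherr's converse half (S5) -/

/-- **`LandherrHyperbolicOfSplitDiscriminant` — the CONVERSE HALF of `LandherrSplitCriterion`, typed on the carriers
(a THEOREM IN PRINT, refereed: Landherr 1936, the Hasse principle for Hermitian forms over a CM field; van Geemen 5.4
"`H` is hyperbolic iff `a ∈ Nm(K^*)`", direction ⇐; Deligne–Milne LNM 900 §4 Cor. 4.2 (a) ⟹ (b); kept as a named
hypothesis, never cited as a fact).** For an abelian `2n`-fold `(A, φ)`, `φ ≫ φ = -(d • 𝟙 A)`, carrying a non-zero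
rational `(n,n)` Weil class (so of Weil type `(n, n)`, van Geemen 6.10–6.11; this hypothesis CANNOT be dropped: a
definite `H` of rank `4` with `det H = 1 ≡ (-1)²` modulo norms is not hyperbolic), and a `K`-symmetrised hyperplane
class `h = d·e^*a + φ^*e^*a` with `det H = (-1)ⁿ` in `ℚ^×/Nm(K^×)`, `H` non-degenerate: `(A, φ)` is HYPERBOLIC for `h`.
After the forward half landed (`hasWeilDiscriminantNondeg_neg_one_pow_of_isHyperbolicWeilType`) this is EXACTLY what
remains of VII-B's binder: `landherrSplitCriterion_iff_hyperbolicOfSplitDiscriminant`. OPEN as a formal statement of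
the tree (obligation node, provable by name by a Literature seat); NOT asserted; not a case of the Hodge conjecture
(arithmetic of Hermitian forms), so no on-path lemma. [cite: vanGeemen1994HodgeAV, Lemma 5.2 (2)–(4), 5.4 and (5.4.1) (PDF p. 220)]
[cite: Landherr1936HermitianForms] [cite: Deligne1982HodgeCycles, §4 Cor. 4.2] [status: open] -/
@[conjecture] def LandherrHyperbolicOfSplitDiscriminant : Prop :=
  ∀ (n d : ℕ), 0 < n → 0 < d → ∀ (A : AbelianVariety ℂ) (φ : A ⟶ A), A.dim = 2 * n → φ ≫ φ = -(d • 𝟙 A) →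
    ∀ (e : ProjectiveEmbedding A.X) (a : complexBetti (projectiveSpace e.n ℂ) 2), IsRationalClass a → a ≠ 0 →
      (∃ c ∈ weilClassesOf A φ n d, IsRationalClass c ∧ IsOfHodgeType (2 * n) A.X (2 * n) n n c ∧ c ≠ 0) →
      HasWeilDiscriminantNondeg A φ n d
          ((d : ℂ) • complexBetti.map e.ι 2 a + complexBetti.map φ.hom.hom.hom 2 (complexBetti.map e.ι 2 a))
          (splitDiscriminantClass n d) →
        IsHyperbolicWeilType A φ n
          ((d : ℂ) • complexBetti.map e.ι 2 a + complexBetti.map φ.hom.hom.hom 2 (complexBetti.map e.ι 2 a))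

/-- The `↔`-node gives its converse half. [cite: vanGeemen1994HodgeAV, 5.4 and (5.4.1)] -/
theorem landherrHyperbolicOfSplitDiscriminant_of_landherrSplitCriterion (hL : LandherrSplitCriterion) :
    LandherrHyperbolicOfSplitDiscriminant :=
  fun n d hn hd A φ hA hφ e a haQ ha0 hc hδ ↦ (hL n d hn hd A φ hA hφ e a haQ ha0 hc).2 hδ

/-- **The converse half gives back the whole `↔`-node**, the forward half being the tree theorem
`hasWeilDiscriminantNondeg_neg_one_pow_of_isHyperbolicWeilType`. [cite: vanGeemen1994HodgeAV, 5.4 and (5.4.1)]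
[cite: Deligne1982HodgeCycles, §4 Cor. 4.2] -/
theorem landherrSplitCriterion_of_hyperbolicOfSplitDiscriminant (hL' : LandherrHyperbolicOfSplitDiscriminant) :
    LandherrSplitCriterion :=
  fun n d hn hd A φ hA hφ e a haQ ha0 hc ↦
    ⟨hasWeilDiscriminantNondeg_neg_one_pow_of_isHyperbolicWeilType hn hA hd hφ e haQ ha0,
      hL' n d hn hd A φ hA hφ e a haQ ha0 hc⟩

/-- **S5 — WHAT REMAINS OF THE BINDER, in the kernel: `LandherrSplitCriterion ↔ LandherrHyperbolicOfSplitDiscriminant`**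
(fact-free). Every row of parts VII-B / XIII and of the `Ring2AbelianAll*` Weil files displaying
`(hL : LandherrSplitCriterion)` is therefore priced by Landherr's converse half alone.
[cite: vanGeemen1994HodgeAV, 5.4 and (5.4.1)] [cite: Landherr1936HermitianForms] -/
theorem landherrSplitCriterion_iff_hyperbolicOfSplitDiscriminant :
    LandherrSplitCriterion ↔ LandherrHyperbolicOfSplitDiscriminant :=
  ⟨landherrHyperbolicOfSplitDiscriminant_of_landherrSplitCriterion,
    landherrSplitCriterion_of_hyperbolicOfSplitDiscriminant⟩

/-! ### §6 VII-B's Landherr rows re-based on the converse half (S6) -/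

/-- S6 — W4 (→) on the converse half: rung R2 gives the split cells `(n, d, (-1)ⁿ)`, `n ≥ 4`.
[cite: vanGeemen1994HodgeAV, (5.4.1)] -/
theorem weilClassesComponent_split_of_splitWeilAbelianVarieties_of_converse
    (hL' : LandherrHyperbolicOfSplitDiscriminant) (h : SplitWeilAbelianVarieties) {n d : ℕ} (hn : 4 ≤ n)
    (hd : 0 < d) : WeilClassesComponent n d (splitDiscriminantClass n d) :=
  weilClassesComponent_split_of_splitWeilAbelianVarieties (landherrSplitCriterion_of_hyperbolicOfSplitDiscriminant hL')
    h hn hd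

/-- **S6 — W4, the split rung IS the union of the split cells, granted ONLY the converse half of Landherr**:
`SplitWeilAbelianVarieties ↔ ∀ n ≥ 4, ∀ d ≥ 1, WeilClassesComponent n d [(-1)ⁿ]` (← is S2, fact-free).
[cite: vanGeemen1994HodgeAV, 5.4 and (5.4.1)] [cite: Markman2025SurveySecant, §12] -/
theorem splitWeilAbelianVarieties_iff_split_components_of_converse (hL' : LandherrHyperbolicOfSplitDiscriminant) :
    SplitWeilAbelianVarieties ↔
      ∀ (n : ℕ), 4 ≤ n → ∀ (d : ℕ), 0 < d → WeilClassesComponent n d (splitDiscriminantClass n d) :=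
  ⟨fun h _ hn _ hd ↦ weilClassesComponent_split_of_splitWeilAbelianVarieties_of_converse hL' h hn hd,
    splitWeilAbelianVarieties_of_split_components_holds⟩

/-- S6 — R1′ `NonsplitSixfolds` from the NON-split sixfold cells `(3, d, δ ≠ -1)`, granted the converse half of
Landherr and the typed Lemma 5.2 (VII-B's `nonsplitSixfolds_of_nonsplit_components`, re-based).
[cite: vanGeemen1994HodgeAV, Lemma 5.2 and (5.4.1)] [cite: Markman2025SurveySecant, §1.1 and §11.5 Step 1] -/
theorem nonsplitSixfolds_of_nonsplit_components_of_converse (hL' : LandherrHyperbolicOfSplitDiscriminant)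
    (hE : PolarizedWeilDiscriminantExists)
    (h : ∀ (d : ℕ), 0 < d → ∀ δ : weilNormResidueGroup d, δ ≠ splitDiscriminantClass 3 d →
      WeilClassesComponent 3 d δ) :
    NonsplitSixfolds :=
  nonsplitSixfolds_of_nonsplit_components (landherrSplitCriterion_of_hyperbolicOfSplitDiscriminant hL') hE h

/-- S6 — W5 cell `(2, d, +1)` from Markman JEMS 2023 Thm. 1.5 (= Thm. 13.4), p. 236 (pre-v4 arXiv text: Thm. 1.3) (REFEREED, by name), granted the converse half only.
[cite: Markman2023GeneralizedKummers, Thm. 1.5 (= Thm. 13.4), p. 236; pre-v4 arXiv text: Thm. 1.3] [cite: vanGeemen1994HodgeAV, (5.4.1)] -/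
theorem weilClassesComponent_split_two_of_markman2023_of_converse (hL' : LandherrHyperbolicOfSplitDiscriminant)
    (hM : Markman2023_weilClasses_algebraic_discOneWeilFourfold) {d : ℕ} (hd : 0 < d) :
    WeilClassesComponent 2 d (splitDiscriminantClass 2 d) :=
  weilClassesComponent_split_two_of_markman2023 (landherrSplitCriterion_of_hyperbolicOfSplitDiscriminant hL') hM hd

/-- S6 — W5 cell `(3, d, -1)` from the floor fact F2 (UNREFEREED, by name), granted the converse half only; with S2's
`hyperbolicSixfolds_of_split_components_holds` the cells `(3, ·, -1)` and F2 are EQUIVALENT granted that half.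
[cite: Markman2025SecantWeil, Thm. 1.5.1 (preprint, unrefereed)] [cite: vanGeemen1994HodgeAV, (5.4.1)] -/
theorem weilClassesComponent_split_three_of_markmanSixfolds_of_converse
    (hL' : LandherrHyperbolicOfSplitDiscriminant) (hM : Markman2025_weilClasses_algebraic_hyperbolicSixfold)
    {d : ℕ} (hd : 0 < d) : WeilClassesComponent 3 d (splitDiscriminantClass 3 d) :=
  weilClassesComponent_split_three_of_markmanSixfolds (landherrSplitCriterion_of_hyperbolicOfSplitDiscriminant hL')
    hM hd

/-- S6 — EXACTNESS of the F2 row granted the converse half: F2 ⟺ all split sixfold cells `(3, d, -1)`.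
[cite: Markman2025SecantWeil, Thm. 1.5.1 (preprint, unrefereed)] [cite: vanGeemen1994HodgeAV, 5.4 and (5.4.1)] -/
theorem hyperbolicSixfolds_iff_split_components_of_converse (hL' : LandherrHyperbolicOfSplitDiscriminant) :
    Markman2025_weilClasses_algebraic_hyperbolicSixfold ↔
      ∀ (d : ℕ), 0 < d → WeilClassesComponent 3 d (splitDiscriminantClass 3 d) :=
  ⟨fun hM _ hd ↦ weilClassesComponent_split_three_of_markmanSixfolds_of_converse hL' hM hd,
    hyperbolicSixfolds_of_split_components_holds⟩

/-- S6 — W5 cell `(3, 3, -1)` from Schoen 1988/1998 (REFEREED, by name), granted the converse half only.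
[cite: Schoen1998HodgeWeilAddendum] [cite: vanGeemen1994HodgeAV, 7.3 and (5.4.1)] -/
theorem weilClassesComponent_split_three_three_of_schoen_of_converse (hL' : LandherrHyperbolicOfSplitDiscriminant)
    (hS : Schoen1998_weilClasses_algebraic_hyperbolicSixfold_three) :
    WeilClassesComponent 3 3 (splitDiscriminantClass 3 3) :=
  weilClassesComponent_split_three_three_of_schoen (landherrSplitCriterion_of_hyperbolicOfSplitDiscriminant hL') hS

/-- S6 — W5 cell `(3, 1, -1)` from Koike 2004 (REFEREED, by name), granted the converse half only.
[cite: Koike2004WeilHodge, Thm. 2.1 and Cor. 2.1] [cite: vanGeemen1994HodgeAV, (5.4.1)] -/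
theorem weilClassesComponent_split_three_one_of_koike_of_converse (hL' : LandherrHyperbolicOfSplitDiscriminant)
    (hK : Koike2004_weilClasses_algebraic_hyperbolicSixfold_one) :
    WeilClassesComponent 3 1 (splitDiscriminantClass 3 1) :=
  weilClassesComponent_split_three_one_of_koike (landherrSplitCriterion_of_hyperbolicOfSplitDiscriminant hL') hK

/-! ### §7 Audit -/

/-- AUDIT (on-path of the data of this file): under the Hodge conjecture every split cell holds (VII-B), hence so do
S2's three conclusions — R2, R2₈ and the F2-statement — by THIS file's fact-free rows; no binder anywhere.
[cite: Deligne2000, §1] [cite: vanGeemen1994HodgeAV, (5.4.1)] -/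
theorem splitRows_of_hodgeConjecture (h : _root_.HodgeConjecture) :
    SplitWeilAbelianVarieties ∧ SplitEightfolds ∧ Markman2025_weilClasses_algebraic_hyperbolicSixfold :=
  ⟨splitWeilAbelianVarieties_of_split_components_holds fun n _ d _ ↦ weilClassesComponent_of_hodgeConjecture h n d _,
    splitEightfolds_of_split_components_holds fun d _ ↦ weilClassesComponent_of_hodgeConjecture h 4 d _,
    hyperbolicSixfolds_of_split_components_holds fun d _ ↦ weilClassesComponent_of_hodgeConjecture h 3 d _⟩

end Summit.HodgeConjecture.HodgeConjecture.Ring2.Hypotheses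

end
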